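import Summits.NavierStokesRegularity.NavierStokesRegularity.Theses.AncientHullSteering
import HarnessLib

/-!
# Route `AncientHullSteering`, rung `AncientTruncationBridge` (stmt-NavierStokesRegularity-20185):
  on-path status — the on-path lemma is EQUIVALENT to a conditional Type-I Liouville theorem

Forward-discipline F4 asks every rung `R` for the landed on-path lemma `S → R`
(`<Rung>_of_<Summit>`), `S` the sub-problem statement (`NavierStokesRegularity`, Clay (A)).
For this rung it is NOT provable cheaply, and this file certifies exactly why, sorry-free:

* `not_typeIBlowupClass_of_navierStokesRegularity` — Clay (A) refutes the CONSEQUENT of the rung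
  (a Leray–Hopf classical solution from a rapidly decaying datum with finite maximal lifespan and
  Type-I rate): by the in-tree weak–strong uniqueness of Clay-class solutions
  (`Theorems.adiabaticEddy_clayUniqueness_proof`, Escauriaza–Seregin–Šverák) the global smooth
  solution of (A) from the same datum coincides with the blowing-up one on `[0, T)` and extends it
  past `T`, contradicting maximality — the argument of the route's own `closes`.
* `ancientTruncationBridge_iff_typeILiouville_of_navierStokesRegularity` — hence, GIVEN (A), the
  rung `AncientTruncationBridge` (antecedent `H` := "some nontrivial ancient mild solution, `ν = 1`,
  measurable slices, Type-I space–time decay `‖u(t,x)‖ ≤ C₀/(‖x‖+√(−t))`" ⟹ consequent) is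
  equivalent to `¬H`, i.e. to the TYPE-I LIOUVILLE STATEMENT for ancient mild solutions
  (Koch–Nadirashvili–Seregin–Šverák 2009, the Liouville conjecture restricted to Type-I decay;
  Albritton–Barker 2019, Thm 1.1, relate it only to LOCAL Type-I singular points of suitable weak
  solutions, not to Schwartz-class data).
* `navierStokesRegularity_imp_ancientTruncationBridge_iff` — therefore the on-path lemma
  `NavierStokesRegularity → AncientTruncationBridge` is equivalent to
  `NavierStokesRegularity → (Type-I Liouville)`, an open implication ("regularity of the Cauchy
  problem for Schwartz data ⟹ no Type-I-decaying ancient mild solution" is the localisation /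
  truncation problem the rung itself addresses). The rung is a BRIDGE between the negative-side
  witness class and finite-energy blow-up, not a special case of the summit: off-path in the
  kernel's sense, with the floor `Theorems.dssTruncationBridgeTypeI_proof` (rotated-DSS profiles,
  stmt-14478) pinning its other end.

Remark (not formalised here, one line each way): the Type-I Liouville statement over ALL ancient
mild solutions refutes the route's sibling crux `SelfExcitedTypeIProfile` (stmt-20186, the bounded
class, `IsBoundedAncientMildSolution.isAncientMildSolution`), so a proof of the on-path lemma would,
under (A), decide the route's designed dichotomy on the Liouville side; and `¬(A) → rung` fails for
want of a Type-I RATE at the blow-up time (¬(A) gives a maximal classical solution of the class by the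
in-tree `CirculationFloor.Negative.circulationFloor_hypotheses_iff_not_navierStokesRegularity`, but
not `IsTypeIBlowup`).

No statement of the route is asserted; every theorem is an implication / equivalence between the
route's declarations and `NavierStokesRegularity`. No new definitions (the Liouville statement is
written inline, in the vocabulary of `Literature.Analysis.FluidPDE`).

References: G. Koch, N. Nadirashvili, G. Seregin, V. Šverák, Acta Math. 203 (2009) §1
[KochNadirashviliSereginSverak2009]; D. Albritton, T. Barker, J. Math. Fluid Mech. 21 (2019) =
arXiv:1811.00502, Thm 1.1 [AlbrittonBarker2019]; L. Escauriaza, G. Seregin, V. Šverák (2003)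
[EscauriazaSereginSverak2003]; C. Fefferman, Clay problem description (2000/2006), (A)
[FeffermanClay2006].
-/

noncomputable section

set_option linter.dupNamespace false

namespace Summit.NavierStokesRegularity.NavierStokesRegularity.Theorems.AncientHullSteeringOnpath

open MeasureTheory Set
open Literature.Analysis.FluidPDE
open Summit.NavierStokesRegularity.NavierStokesRegularity.Theses.AncientHullSteering

/-- **Clay (A) refutes the consequent of the rung.** Under `NavierStokesRegularity` there is no
`ν > 0`, `T > 0` and Leray–Hopf classical solution `(u, p)` of unforced Navier–Stokes from a rapidly
decaying datum with maximal smooth lifespan `T` (let alone with the Type-I rate at `T`): (A) gives a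
global smooth bounded-energy solution from `u 0`, which agrees with `u` on `[0, T)` by the proved
Clay-class uniqueness `Theorems.adiabaticEddy_clayUniqueness_proof` and so extends `u` smoothly past
`T`. (The argument of `Theses.AncientHullSteering.closes`.) [folklore] -/
theorem not_typeIBlowupClass_of_navierStokesRegularity (hA : _root_.NavierStokesRegularity) :
    ¬ ∃ ν : ℝ, 0 < ν ∧ ∃ T : ℝ, 0 < T ∧
      ∃ (u : ℝ → EuclideanSpace ℝ (Fin 3) → EuclideanSpace ℝ (Fin 3))
        (p : ℝ → EuclideanSpace ℝ (Fin 3) → ℝ),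
      IsMaximalSmoothSolution ν 0 u p T ∧ IsLerayHopfOn T ν 0 (u 0) u ∧
        HasRapidSpatialDecay (u 0) ∧ IsTypeIBlowup u T := by
  rintro ⟨ν, hν, T, hT, u, p, ⟨hcl, hmax⟩, hLH, hdec, -⟩
  have hU := _root_.Summit.NavierStokesRegularity.NavierStokesRegularity.Theorems.adiabaticEddy_clayUniqueness_proof
  have h0 : (0 : ℝ) ∈ Set.Ico 0 T := ⟨le_rfl, hT⟩
  obtain ⟨u', p', hu', hp', hns, hbe⟩ :=
    hA ν hν (u 0) (hcl.contDiff_velocity h0) (hcl.divFree 0 h0) hdec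
  have heq : ∀ t ∈ Set.Ico 0 T, u' t = u t :=
    hU ν hν (u 0) hdec u' u p' p T hT hu' hp' hns hbe hcl hLH rfl
  have hcl' : IsClassicalNSSolutionOn (Set.Ici 0) ν 0 u' p' :=
    ⟨hu', hp', fun t ht x => hns.momentum t ht x, fun t ht => hns.divFree t ht⟩
  refine hmax ⟨T + 1, by linarith, u', p', ?_, heq⟩
  exact hcl'.mono (fun t ht => ht.1) (uniqueDiffOn_Ico 0 (T + 1))

/-- **Given Clay (A), the rung is equivalent to the Type-I Liouville statement.** Under
`NavierStokesRegularity`, `AncientTruncationBridge` holds iff every ancient mild solution (`ν = 1`)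
with measurable slices and Type-I space–time decay `‖u(t,x)‖ ≤ C₀/(‖x‖+√(−t))` has a.e.-vanishing
slices (the Koch–Nadirashvili–Seregin–Šverák Liouville conjecture restricted to Type-I decay, here
over all ancient mild solutions): `→` because (A) refutes the rung's consequent
(`not_typeIBlowupClass_of_navierStokesRegularity`), `←` vacuously. [cite: KochNadirashviliSereginSverak2009, §1] -/
theorem ancientTruncationBridge_iff_typeILiouville_of_navierStokesRegularity
    (hA : _root_.NavierStokesRegularity) :
    AncientTruncationBridge ↔
      ∀ u : ℝ → EuclideanSpace ℝ (Fin 3) → EuclideanSpace ℝ (Fin 3), IsAncientMildSolution 1 u →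
        (∀ t < 0, AEStronglyMeasurable (u t) volume) → (∃ C₀ : ℝ, HasTypeIDecay C₀ u) →
          ∀ t < 0, u t =ᵐ[volume] 0 := by
  constructor
  · intro hR u hu hmeas hdec
    by_contra hnt
    exact not_typeIBlowupClass_of_navierStokesRegularity hA (hR ⟨u, hu, hmeas, hdec, hnt⟩)
  · rintro hL ⟨u, hu, hmeas, hdec, hnt⟩
    exact absurd (hL u hu hmeas hdec) hnt

/-- **The on-path lemma is a conditional Liouville theorem.** `NavierStokesRegularity →
AncientTruncationBridge` (forward-discipline F4's `<Rung>_of_<Summit>` for this rung) holds iff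
Clay (A) implies the Type-I Liouville statement for ancient mild solutions — an open implication
(Albritton–Barker 2019, Thm 1.1, tie Type-I-decaying ancient mild solutions to LOCAL Type-I singular
points of suitable weak solutions only; the passage to Schwartz-class data is the truncation problem
of the rung itself). Hence the rung is off the summit's path in the kernel's sense. [cite: AlbrittonBarker2019, Thm 1.1] -/
theorem navierStokesRegularity_imp_ancientTruncationBridge_iff :
    (_root_.NavierStokesRegularity → AncientTruncationBridge) ↔
      (_root_.NavierStokesRegularity →
        ∀ u : ℝ → EuclideanSpace ℝ (Fin 3) → EuclideanSpace ℝ (Fin 3), IsAncientMildSolution 1 u →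
          (∀ t < 0, AEStronglyMeasurable (u t) volume) → (∃ C₀ : ℝ, HasTypeIDecay C₀ u) →
            ∀ t < 0, u t =ᵐ[volume] 0) :=
  ⟨fun h hA => (ancientTruncationBridge_iff_typeILiouville_of_navierStokesRegularity hA).1 (h hA),
    fun h hA => (ancientTruncationBridge_iff_typeILiouville_of_navierStokesRegularity hA).2 (h hA)⟩

end Summit.NavierStokesRegularity.NavierStokesRegularity.Theorems.AncientHullSteeringOnpath

end
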